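import Summits.NavierStokesRegularity.OSWSelfSimilar.SheetNSLineTorusCascadeWiener
import Summits.NavierStokesRegularity.OSWSelfSimilar.SheetNSLineTorusCascadeStationaryPole
import HarnessLib

/-!
# Viscous CLM on the torus (`a = 0`, `σ = 2`): the SUPER-SOLUTION TAIL LEMMA — time-uniform bounds on finitely many modes
# propagate to a pole bound `B k β^{−k}` on ALL higher modes (kernel half of the global-existence certificate)

HONEST FRAMING (cell ns-blowup GROUP B «PROFILE SEARCH», zone Z3, row Z3-U addendum A-F2 of `HOME/profile/z3/CENSUS-Z3.md`;
human rulings D-0035/D-0074): **1-D MODEL (viscous Constantin–Lax–Majda equation `ω_t = ω Hω + ν ω_xx` on `𝕋 = ℝ/2πℤ`);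
ODE calculus on Fourier-coefficient families, kernel-checked; not Euler, not Navier–Stokes; «violates: none — MODEL».**

OBJECT: the sine-datum cascade `IsSineCascade ν c e` (`SheetNSLineTorusCascade`). `SheetNSLineTorusCascadeStationaryPole` bounded
ALL modes by the stationary pole `12ν k (c/12ν)^k` (global for `c < 12ν`). HERE the same mechanism is started at an arbitrary mode
`K₀`, from time-uniform bounds `e_j ≤ U_j` (`j ≤ K₀`, `t ∈ [0, T]`) that need NOT have the pole shape: writing `U_j β^j ≤ B j + X_j`
with excesses `X_j ≥ 0`, `Σ_{j≤K₀} X_j ≤ E`,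

* `super_step` — on a window `[T₁, T]`: if `Σ_{i+j=k} e_i e_j ≤ 2M` there, then `e_k(s) ≤ e_k(T₁) e^{−νk²(s−T₁)} + M/(νk²)`;
* `conv_pole_excess_le` — `Σ_{i+j=k} Ū_i Ū_j ≤ β^{−k}(B²(k³−k)/6 + 2Bk·E_k + E_k²)` whenever `0 ≤ Ū_i β^i ≤ B i + X_i`, `X_i ≥ 0`
  (`E_k = Σ_{i≤k} X_i`);
* `super_tail_induction` — **if `e_j ≤ U_j` on `[0,T]` (`j ≤ K₀`), `U_j β^j ≤ B j + X_j`, `Σ_{j≤K₀} X_j ≤ E`, and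
  `B/(12ν) + E/(ν(K₀+1)²) + E²/(2Bν(K₀+1)³) ≤ 1`, then `e_k(t) ≤ B k β^{−k}` for EVERY `k > K₀`, `t ∈ [0, T]`.**
USE (the global-existence certificate, `HOME/profile/z3/SHEET.md` §15): validated upper bounds `U_j` (`j ≤ K₀`) for the universal
cascade on `[0, T]` + this lemma give `sup_{t≤T} Σ_k c^k e_k(t) < ∞` for `c < β`; the late window (same `super_step` with `T₁ > 0`,
pen assembly) and `IsNonnegCascade.partialSum_le_riccati` on the time-shifted cascade give boundedness after `T`. bears_on: LADDER-NS
N5 / zone Z3 (row Z3-U) → N1 linear core. WHAT THIS IS NOT: not NS; the bounds `U_j` are the certified-numerics INPUT, not proved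
here; sine datum only. No definitions.
-/

namespace Summit.NavierStokesRegularity.OSWSelfSimilar
namespace SheetNSLineTorusCascade

open Finset Real Set

variable {ν c : ℝ} {e : ℕ → ℝ → ℝ}

/-- **SUPER STEP on a window.** If `0 ≤ T₁`, `0 ≤ M` and `Σ_{i+j=k} e_i(s) e_j(s) ≤ 2M` for `s ∈ [T₁, T]`, then for
`s ∈ [T₁, T]`: `e_k(s) ≤ e_k(T₁) e^{−νk²(s−T₁)} + M/(νk²)` (`k ≥ 1`, `ν > 0`). [new here — MODEL] -/
theorem super_step (he : IsSineCascade ν c e) (hν : 0 < ν) {k : ℕ} (hk : 1 ≤ k) {T₁ T M : ℝ} (hT₁ : 0 ≤ T₁) (hM : 0 ≤ M)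
    (hconv : ∀ s ∈ Icc T₁ T, ∑ p ∈ antidiagonal k, e p.1 s * e p.2 s ≤ 2 * M) :
    ∀ s ∈ Icc T₁ T, e k s ≤ e k T₁ * exp (-(ν * (k : ℝ) ^ 2 * (s - T₁))) + M / (ν * (k : ℝ) ^ 2) := by
  intro s hs
  have hk0 : (0 : ℝ) < k := by exact_mod_cast hk
  have hνk : 0 < ν * (k : ℝ) ^ 2 := by positivity
  set Cst : ℝ := M / (ν * (k : ℝ) ^ 2) with hCst
  have hCst0 : 0 ≤ Cst := by positivity
  have hanti : AntitoneOn (fun σ => exp (ν * (k : ℝ) ^ 2 * σ) * e k σ - Cst * exp (ν * (k : ℝ) ^ 2 * σ)) (Icc T₁ T) := by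
    refine antitoneOn_of_hasDerivWithinAt_nonpos
      (f' := fun σ => exp (ν * (k : ℝ) ^ 2 * σ) * ((1 / 2) * ∑ p ∈ antidiagonal k, e p.1 σ * e p.2 σ)
        - Cst * (exp (ν * (k : ℝ) ^ 2 * σ) * (ν * (k : ℝ) ^ 2)))
      (convex_Icc T₁ T) ?_ (fun σ hσ => ?_) (fun σ hσ => ?_)
    · exact ((continuousOn_weighted he k).mono (fun σ hσ => le_trans hT₁ hσ.1)).sub
        ((continuous_const.mul (continuous_exp.comp (continuous_const.mul continuous_id))).continuousOn)
    · rw [interior_Icc] at hσ ⊢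
      have h2 : HasDerivAt (fun σ => Cst * exp (ν * (k : ℝ) ^ 2 * σ)) (Cst * (exp (ν * (k : ℝ) ^ 2 * σ) * (ν * (k : ℝ) ^ 2))) σ := by
        have := ((hasDerivAt_id σ).const_mul (ν * (k : ℝ) ^ 2)).exp.const_mul Cst
        simpa using this
      exact ((hasDerivAt_weighted he k (lt_of_le_of_lt hT₁ hσ.1)).sub h2).hasDerivWithinAt
    · rw [interior_Icc] at hσ
      have hc' := hconv σ ⟨hσ.1.le, hσ.2.le⟩
      have hid : Cst * (exp (ν * (k : ℝ) ^ 2 * σ) * (ν * (k : ℝ) ^ 2)) = exp (ν * (k : ℝ) ^ 2 * σ) * M := by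
        rw [hCst]; field_simp
      rw [hid, ← mul_sub]
      exact mul_nonpos_iff.mpr (Or.inl ⟨(exp_pos _).le, by linarith⟩)
  have h := hanti ⟨le_rfl, le_trans hs.1 hs.2⟩ hs hs.1
  have hET : 0 ≤ Cst * exp (ν * (k : ℝ) ^ 2 * T₁) := by positivity
  have key : exp (ν * (k : ℝ) ^ 2 * s) * e k s ≤ exp (ν * (k : ℝ) ^ 2 * T₁) * e k T₁ + Cst * exp (ν * (k : ℝ) ^ 2 * s) := by
    simp only at h; linarith
  have hinv : exp (-(ν * (k : ℝ) ^ 2 * s)) * exp (ν * (k : ℝ) ^ 2 * s) = 1 := by rw [← exp_add]; simp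
  have hsplit : exp (-(ν * (k : ℝ) ^ 2 * (s - T₁))) = exp (-(ν * (k : ℝ) ^ 2 * s)) * exp (ν * (k : ℝ) ^ 2 * T₁) := by
    rw [← exp_add]; congr 1; ring
  have hE' : 0 < exp (-(ν * (k : ℝ) ^ 2 * s)) := exp_pos _
  calc e k s = exp (-(ν * (k : ℝ) ^ 2 * s)) * (exp (ν * (k : ℝ) ^ 2 * s) * e k s) := by
        rw [← mul_assoc, hinv, one_mul]
    _ ≤ exp (-(ν * (k : ℝ) ^ 2 * s)) * (exp (ν * (k : ℝ) ^ 2 * T₁) * e k T₁ + Cst * exp (ν * (k : ℝ) ^ 2 * s)) :=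
        mul_le_mul_of_nonneg_left key hE'.le
    _ = e k T₁ * exp (-(ν * (k : ℝ) ^ 2 * (s - T₁))) + Cst := by
        rw [hsplit, mul_add]
        have : exp (-(ν * (k : ℝ) ^ 2 * s)) * (Cst * exp (ν * (k : ℝ) ^ 2 * s)) = Cst := by
          calc exp (-(ν * (k : ℝ) ^ 2 * s)) * (Cst * exp (ν * (k : ℝ) ^ 2 * s))
              = Cst * (exp (-(ν * (k : ℝ) ^ 2 * s)) * exp (ν * (k : ℝ) ^ 2 * s)) := by ring
            _ = Cst := by rw [hinv, mul_one]
        rw [this]; ring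

/-- `Σ_{i+j=k} i·j = (k³ − k)/6` over `ℝ`. [folklore; via `stationaryPole_conv` with `ν = 1/12`, `q = 1`] -/
theorem antidiagonal_sum_mul_cast (k : ℕ) :
    ∑ p ∈ antidiagonal k, (p.1 : ℝ) * (p.2 : ℝ) = ((k : ℝ) ^ 3 - k) / 6 := by
  have h := stationaryPole_conv (1 / 12) 1 k
  have hs : ∑ p ∈ antidiagonal k, (12 * (1 / 12 : ℝ) * (p.1 : ℝ) * 1 ^ p.1) * (12 * (1 / 12) * (p.2 : ℝ) * 1 ^ p.2)
      = ∑ p ∈ antidiagonal k, (p.1 : ℝ) * (p.2 : ℝ) := by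
    refine sum_congr rfl fun p _ => ?_
    simp
  rw [hs] at h
  rw [h]; ring

/-- **The convolution estimate with low-mode excess.** If `0 ≤ Ū_i`, `0 ≤ X_i` and `Ū_i β^i ≤ B i + X_i` for all `i ≤ k`
(`β > 0`, `B ≥ 0`), then `Σ_{i+j=k} Ū_i Ū_j ≤ β^{−k}·(B²(k³−k)/6 + 2Bk·E_k + E_k²)` with `E_k = Σ_{i≤k} X_i`. [new here — MODEL] -/
theorem conv_pole_excess_le {U X : ℕ → ℝ} {β B : ℝ} (hβ : 0 < β) (hB : 0 ≤ B) (k : ℕ)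
    (hU0 : ∀ i, i ≤ k → 0 ≤ U i) (hX0 : ∀ i, i ≤ k → 0 ≤ X i)
    (hUX : ∀ i, i ≤ k → U i * β ^ i ≤ B * (i : ℝ) + X i) :
    ∑ p ∈ antidiagonal k, U p.1 * U p.2
      ≤ (β ^ k)⁻¹ * (B ^ 2 * (((k : ℝ) ^ 3 - k) / 6) + 2 * B * (k : ℝ) * (∑ i ∈ range (k + 1), X i)
          + (∑ i ∈ range (k + 1), X i) ^ 2) := by
  set E : ℝ := ∑ i ∈ range (k + 1), X i with hE
  have hE0 : 0 ≤ E := sum_nonneg fun i hi => hX0 i (Nat.lt_succ_iff.mp (mem_range.mp hi))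
  -- termwise: U_i U_j = β^{-k} (U_i β^i)(U_j β^j) ≤ β^{-k} (B i + X_i)(B j + X_j)
  have hterm : ∀ p ∈ antidiagonal k, U p.1 * U p.2 ≤ (β ^ k)⁻¹ * ((B * (p.1 : ℝ) + X p.1) * (B * (p.2 : ℝ) + X p.2)) := by
    intro p hp
    have hsum : p.1 + p.2 = k := mem_antidiagonal.mp hp
    have h1 := hUX p.1 (by omega); have h2 := hUX p.2 (by omega)
    have hβk : β ^ k = β ^ p.1 * β ^ p.2 := by rw [← pow_add, hsum]
    have hnn1 : 0 ≤ U p.1 * β ^ p.1 := mul_nonneg (hU0 p.1 (by omega)) (pow_nonneg hβ.le _)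
    have hnn2 : 0 ≤ U p.2 * β ^ p.2 := mul_nonneg (hU0 p.2 (by omega)) (pow_nonneg hβ.le _)
    have hprod : (U p.1 * β ^ p.1) * (U p.2 * β ^ p.2) ≤ (B * (p.1 : ℝ) + X p.1) * (B * (p.2 : ℝ) + X p.2) :=
      mul_le_mul h1 h2 hnn2 (le_trans hnn1 h1)
    rw [hβk, mul_inv, show U p.1 * U p.2 = ((β ^ p.1)⁻¹ * (U p.1 * β ^ p.1)) * ((β ^ p.2)⁻¹ * (U p.2 * β ^ p.2)) by
      field_simp]
    calc (β ^ p.1)⁻¹ * (U p.1 * β ^ p.1) * ((β ^ p.2)⁻¹ * (U p.2 * β ^ p.2))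
        = (β ^ p.1)⁻¹ * (β ^ p.2)⁻¹ * ((U p.1 * β ^ p.1) * (U p.2 * β ^ p.2)) := by ring
      _ ≤ (β ^ p.1)⁻¹ * (β ^ p.2)⁻¹ * ((B * (p.1 : ℝ) + X p.1) * (B * (p.2 : ℝ) + X p.2)) :=
          mul_le_mul_of_nonneg_left hprod (by positivity)
  refine le_trans (sum_le_sum hterm) ?_
  rw [← mul_sum]
  refine mul_le_mul_of_nonneg_left ?_ (by positivity)
  -- expand the sum of products
  have hexp : ∑ p ∈ antidiagonal k, (B * (p.1 : ℝ) + X p.1) * (B * (p.2 : ℝ) + X p.2)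
      = B ^ 2 * ∑ p ∈ antidiagonal k, (p.1 : ℝ) * (p.2 : ℝ)
        + B * (∑ p ∈ antidiagonal k, ((p.2 : ℝ) * X p.1 + (p.1 : ℝ) * X p.2))
        + ∑ p ∈ antidiagonal k, X p.1 * X p.2 := by
    rw [mul_sum, mul_sum, ← sum_add_distrib, ← sum_add_distrib]
    refine sum_congr rfl fun p _ => ?_; ring
  rw [hexp, antidiagonal_sum_mul_cast]
  -- middle: Σ (p2 X_{p1} + p1 X_{p2}) ≤ 2 k E ; last: Σ X_{p1} X_{p2} ≤ E²
  have hmid : ∑ p ∈ antidiagonal k, ((p.2 : ℝ) * X p.1 + (p.1 : ℝ) * X p.2) ≤ 2 * (k : ℝ) * E := by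
    have hle : ∀ p ∈ antidiagonal k, (p.2 : ℝ) * X p.1 + (p.1 : ℝ) * X p.2 ≤ (k : ℝ) * X p.1 + (k : ℝ) * X p.2 := by
      intro p hp
      have hsum : p.1 + p.2 = k := mem_antidiagonal.mp hp
      have h1 : (p.1 : ℝ) ≤ k := by exact_mod_cast (show p.1 ≤ k by omega)
      have h2 : (p.2 : ℝ) ≤ k := by exact_mod_cast (show p.2 ≤ k by omega)
      nlinarith [hX0 p.1 (by omega), hX0 p.2 (by omega)]
    refine le_trans (sum_le_sum hle) ?_
    rw [sum_add_distrib, ← mul_sum, ← mul_sum]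
    have hs1 : ∑ p ∈ antidiagonal k, X p.1 = E := by
      rw [hE, Nat.sum_antidiagonal_eq_sum_range_succ (fun i _ => X i) k]
    have hs2 : ∑ p ∈ antidiagonal k, X p.2 = E := by
      rw [hE, Nat.sum_antidiagonal_eq_sum_range_succ (fun i j => X j) k]
      show ∑ j ∈ range (k + 1), X (k - j) = ∑ i ∈ range (k + 1), X i
      have h := Finset.sum_range_reflect X (k + 1)
      simp only [Nat.add_sub_cancel] at h
      exact h
    rw [hs1, hs2]; linarith
  have hlast : ∑ p ∈ antidiagonal k, X p.1 * X p.2 ≤ E ^ 2 := by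
    rw [hE, sq, sum_mul_sum, ← sum_product']
    refine sum_le_sum_of_subset_of_nonneg ?_ (fun p hp _ => ?_)
    · intro p hp
      have hpk := HasAntidiagonal.mem_antidiagonal.mp hp
      rw [Finset.mem_product, Finset.mem_range, Finset.mem_range]; omega
    · rw [Finset.mem_product, Finset.mem_range, Finset.mem_range] at hp
      exact mul_nonneg (hX0 _ (by omega)) (hX0 _ (by omega))
  nlinarith [mul_le_mul_of_nonneg_left hmid hB]

/-- **SUPER-TAIL INDUCTION (time-uniform).** Let `ν > 0`, `c ≥ 0`, `K₀ ≥ 1`, `β > 0`, `0 < B`. Suppose `e_j(s) ≤ U_j` for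
`j ≤ K₀`, `s ∈ [0, T]`, with `0 ≤ U_j`, `U_j β^j ≤ B j + X_j`, `0 ≤ X_j`, `Σ_{j ≤ K₀} X_j ≤ E`, and
`B/(12ν) + E/(ν(K₀+1)²) + E²/(2Bν(K₀+1)³) ≤ 1`. Then `e_k(t) ≤ B k β^{−k}` for every `k > K₀`, `t ∈ [0, T]`. [new here — MODEL] -/
theorem super_tail_induction (he : IsSineCascade ν c e) (hν : 0 < ν) (hc : 0 ≤ c) {K₀ : ℕ} (hK₀ : 1 ≤ K₀) {T β B E : ℝ}
    (hβ : 0 < β) (hB : 0 < B) {U X : ℕ → ℝ} (hU0 : ∀ j, 0 ≤ U j) (hX0 : ∀ j, 0 ≤ X j)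
    (hUe : ∀ j, j ≤ K₀ → ∀ s ∈ Icc 0 T, e j s ≤ U j) (hUX : ∀ j, j ≤ K₀ → U j * β ^ j ≤ B * (j : ℝ) + X j)
    (hXE : ∑ j ∈ range (K₀ + 1), X j ≤ E)
    (hcond : B / (12 * ν) + E / (ν * ((K₀ : ℝ) + 1) ^ 2) + E ^ 2 / (2 * B * ν * ((K₀ : ℝ) + 1) ^ 3) ≤ 1) :
    ∀ k : ℕ, K₀ < k → ∀ t ∈ Icc 0 T, e k t ≤ B * (k : ℝ) * (β ^ k)⁻¹ := by
  have hE0 : 0 ≤ E := le_trans (sum_nonneg fun j _ => hX0 j) hXE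
  intro k
  induction k using Nat.strong_induction_on with
  | _ k ih =>
    intro hk t ht
    -- the comparison bounds Ū, X̄ on modes ≤ k
    set Ub : ℕ → ℝ := fun i => if i ≤ K₀ then U i else B * (i : ℝ) * (β ^ i)⁻¹ with hUb
    set Xb : ℕ → ℝ := fun i => if i ≤ K₀ then X i else 0 with hXb
    have hUb0 : ∀ i, i ≤ k → 0 ≤ Ub i := by
      intro i _; simp only [hUb]; split_ifs
      · exact hU0 i
      · positivity
    have hXb0 : ∀ i, i ≤ k → 0 ≤ Xb i := by
      intro i _; simp only [hXb]; split_ifs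
      · exact hX0 i
      · exact le_rfl
    have hUXb : ∀ i, i ≤ k → Ub i * β ^ i ≤ B * (i : ℝ) + Xb i := by
      intro i _; simp only [hUb, hXb]; split_ifs with h
      · exact hUX i h
      · rw [add_zero]
        have : B * (i : ℝ) * (β ^ i)⁻¹ * β ^ i = B * (i : ℝ) := by field_simp
        rw [this]
    -- lower modes are ≤ Ub on [0, T]
    have hlow : ∀ i, i < k → ∀ s ∈ Icc 0 T, e i s ≤ Ub i := by
      intro i hi s hs
      simp only [hUb]; split_ifs with h
      · exact hUe i h s hs
      · exact ih i hi (by omega) s hs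
    -- Σ_{i≤k} Xb i ≤ E
    have hXbE : ∑ i ∈ range (k + 1), Xb i ≤ E := by
      have : ∑ i ∈ range (k + 1), Xb i = ∑ i ∈ range (K₀ + 1), X i := by
        rw [← sum_range_add_sum_Ico _ (show K₀ + 1 ≤ k + 1 by omega)]
        have h1 : ∑ i ∈ range (K₀ + 1), Xb i = ∑ i ∈ range (K₀ + 1), X i :=
          sum_congr rfl fun i hi => by simp only [hXb, if_pos (Nat.lt_succ_iff.mp (mem_range.mp hi))]
        have h2 : ∑ i ∈ Ico (K₀ + 1) (k + 1), Xb i = 0 :=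
          sum_eq_zero fun i hi => by
            simp only [hXb, if_neg (show ¬ i ≤ K₀ by have := (mem_Ico.mp hi).1; omega)]
        rw [h1, h2, add_zero]
      rw [this]; exact hXE
    -- the convolution bound on [0, T]
    have hconv : ∀ s ∈ Icc 0 T, ∑ p ∈ antidiagonal k, e p.1 s * e p.2 s
        ≤ 2 * ((β ^ k)⁻¹ * (B ^ 2 * (((k : ℝ) ^ 3 - k) / 6) + 2 * B * (k : ℝ) * E + E ^ 2) / 2) := by
      intro s hs
      have h1 : ∑ p ∈ antidiagonal k, e p.1 s * e p.2 s ≤ ∑ p ∈ antidiagonal k, Ub p.1 * Ub p.2 := by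
        refine sum_le_sum fun p hp => ?_
        have hsum : p.1 + p.2 = k := mem_antidiagonal.mp hp
        rcases Nat.eq_zero_or_pos p.1 with h0 | h0
        · rw [h0, he.zero, zero_mul]; exact mul_nonneg (hUb0 0 (by omega)) (hUb0 p.2 (by omega))
        rcases Nat.eq_zero_or_pos p.2 with h0' | h0'
        · rw [h0', he.zero, mul_zero]; exact mul_nonneg (hUb0 p.1 (by omega)) (hUb0 0 (by omega))
        exact mul_le_mul (hlow p.1 (by omega) s hs) (hlow p.2 (by omega) s hs) (nonneg he hc _ s hs.1) (hUb0 p.1 (by omega))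
      have h2 := conv_pole_excess_le (U := Ub) (X := Xb) hβ hB.le k hUb0 hXb0 hUXb
      have h3 : (β ^ k)⁻¹ * (B ^ 2 * (((k : ℝ) ^ 3 - k) / 6) + 2 * B * (k : ℝ) * (∑ i ∈ range (k + 1), Xb i)
            + (∑ i ∈ range (k + 1), Xb i) ^ 2)
          ≤ (β ^ k)⁻¹ * (B ^ 2 * (((k : ℝ) ^ 3 - k) / 6) + 2 * B * (k : ℝ) * E + E ^ 2) := by
        refine mul_le_mul_of_nonneg_left ?_ (by positivity)
        have hS0 : 0 ≤ ∑ i ∈ range (k + 1), Xb i := sum_nonneg fun i hi => hXb0 i (Nat.lt_succ_iff.mp (mem_range.mp hi))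
        nlinarith [mul_le_mul hXbE hXbE hS0 hE0, mul_le_mul_of_nonneg_left hXbE (by positivity : 0 ≤ 2 * B * (k : ℝ))]
      linarith
    have hk1 : 1 ≤ k := by omega
    have hk2 : 2 ≤ k := by omega
    have hk3 : 0 ≤ (k : ℝ) ^ 3 - k := by
      have h1 : (1 : ℝ) ≤ k := by exact_mod_cast hk1
      have hid : (k : ℝ) ^ 3 - k = (k : ℝ) * ((k : ℝ) - 1) * ((k : ℝ) + 1) := by ring
      rw [hid]
      exact mul_nonneg (mul_nonneg (by linarith) (by linarith)) (by linarith)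
    have hM0 : 0 ≤ (β ^ k)⁻¹ * (B ^ 2 * (((k : ℝ) ^ 3 - k) / 6) + 2 * B * (k : ℝ) * E + E ^ 2) / 2 := by
      positivity
    have hstep := super_step he hν hk1 (T₁ := 0) (T := T) le_rfl hM0 hconv t ht
    rw [he.init_zero k hk2, zero_mul, zero_add] at hstep
    refine le_trans hstep ?_
    -- M/(νk²) ≤ B k β^{-k}  ⇔  the tail condition at k (implied by hcond since k ≥ K₀+1)
    have hkK : ((K₀ : ℝ) + 1) ≤ k := by exact_mod_cast hk
    have hk0 : (0 : ℝ) < k := by positivity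
    have hK1 : (0 : ℝ) < (K₀ : ℝ) + 1 := by positivity
    rw [div_div, div_le_iff₀ (by positivity)]
    -- goal: (β^k)⁻¹ * (B²(k³−k)/6 + 2BkE + E²) ≤ B k (β^k)⁻¹ * (2 (ν k²))
    have hβk : 0 < (β ^ k)⁻¹ := by positivity
    suffices h : B ^ 2 * (((k : ℝ) ^ 3 - k) / 6) + 2 * B * (k : ℝ) * E + E ^ 2 ≤ B * (k : ℝ) * (2 * (ν * (k : ℝ) ^ 2)) by
      nlinarith [mul_le_mul_of_nonneg_left h hβk.le]
    -- from hcond: B/(12ν) + E/(ν k²) + E²/(2Bν k³) ≤ 1 since k ≥ K₀+1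
    have h1 : E / (ν * (k : ℝ) ^ 2) ≤ E / (ν * ((K₀ : ℝ) + 1) ^ 2) := by
      apply div_le_div_of_nonneg_left hE0 (by positivity)
      exact mul_le_mul_of_nonneg_left (pow_le_pow_left₀ hK1.le hkK 2) hν.le
    have h2 : E ^ 2 / (2 * B * ν * (k : ℝ) ^ 3) ≤ E ^ 2 / (2 * B * ν * ((K₀ : ℝ) + 1) ^ 3) := by
      apply div_le_div_of_nonneg_left (by positivity) (by positivity)
      exact mul_le_mul_of_nonneg_left (pow_le_pow_left₀ hK1.le hkK 3) (by positivity)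
    have hc' : B / (12 * ν) + E / (ν * (k : ℝ) ^ 2) + E ^ 2 / (2 * B * ν * (k : ℝ) ^ 3) ≤ 1 := by linarith
    have hν0 : ν ≠ 0 := hν.ne'
    have hB0 : B ≠ 0 := hB.ne'
    have hkne : (k : ℝ) ≠ 0 := hk0.ne'
    have key : B ^ 2 * (k : ℝ) ^ 3 / 6 + 2 * B * (k : ℝ) * E + E ^ 2 ≤ 2 * B * ν * (k : ℝ) ^ 3 := by
      have := mul_le_mul_of_nonneg_left hc' (by positivity : (0 : ℝ) ≤ 2 * B * ν * (k : ℝ) ^ 3)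
      rw [mul_one] at this
      have hid : 2 * B * ν * (k : ℝ) ^ 3 * (B / (12 * ν) + E / (ν * (k : ℝ) ^ 2) + E ^ 2 / (2 * B * ν * (k : ℝ) ^ 3))
          = B ^ 2 * (k : ℝ) ^ 3 / 6 + 2 * B * (k : ℝ) * E + E ^ 2 := by
        field_simp
        ring
      linarith [hid]
    have hdrop : B ^ 2 * (((k : ℝ) ^ 3 - k) / 6) ≤ B ^ 2 * (k : ℝ) ^ 3 / 6 := by
      have : 0 ≤ B ^ 2 * (k : ℝ) / 6 := by positivity
      nlinarith
    nlinarith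

end SheetNSLineTorusCascade
end Summit.NavierStokesRegularity.OSWSelfSimilar
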